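import Summits.QuantumFields.BalabanUV.T4Continuum.Support.NE7EtaPlainGradientLetters
import Summits.QuantumFields.BalabanUV.T4Continuum.Support.NE7EtaMinimiserGaugeCovariance

/-!
# NE7EtaSmoothGaugeTransport — route #1 of the NE7 crux, stub S7 (NODE O, the BACKGROUND COORDINATE): the two smooth-gauge letters of
# `W = rescale L (bavg L U_B)` FROM ONE LETTER ON `U_B` (Bałaban's side estimate, one averaging), and the PAIR of minimisers moved
# TOGETHER to the datum of the smooth gauge — the bill of NODE O's background coordinate reduced by one item

Cell `pub-balaban`, rung (B)+1 sub-cell t4, lineage `b2b-balaban-t4-ne7-p1`, generation 24 (CRUX PROVER NE7 #1, ruling e34b3e0c); crux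
skeleton `t4/skeletons/NE7-CRUX-R1.md` v1.7.2 §3quinquies ∕ §5 (G5); sequel of `NE7EtaPlainGradientLetters` (p256062) and
`NE7EtaMinimiserGaugeCovariance` (p256168).  HONEST FRAMING (page 1): FIXED FINITE T⁴, rung (B)+1; NE7, NE3 NOT PRINTED in
[Balaban1984PropagatorsI]–[Balaban1989LargeFieldII] and NOT PROVED here; continuum YM on T⁴ ⇐ BetaPertH ∧ nine spine estimates (0/9 proved);
BetaPertH ⇐ (D1) ∧ (D4) ∧ CAP+tail; G-an2-4 gates asym, D1 and NE2/3/4; NOT infinite volume, NOT mass gap, NOT Clay.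

WHAT (the bill (G5) item (3) «run B in a smooth gauge, carried through one averaging» made precise, [folklore] over landed modules):
 * §1 `norm_rescale_bavg_sub_one_le` — if `U = exp A` bondwise with `‖A_b‖ ≤ a` EVERYWHERE and `(2dL + 2L)·a ≤ 1∕64`, then every bond of
   `rescale L (bavg L U)` is within `2(2dL + 2L)·a` of `1` — ONE CALL of [Balaban1985Averaging] p. 25's side estimate (tree
   `B7Prop1Explicit.side_estimate`, in the gauge `V₀ = exp A`; the `l¹`-ball is taken around the bond's own base point); `letter_grad_of_sup` —
   the plain-gradient letter is at most twice the sup letter (`s₁ ≤ 2s₀`, triangle inequality).  So the TWO letters `s₀, s₁` of W that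
   `NE7EtaPlainGradientLetters.plain_closeness_of_covRoot₂` displays follow from ONE letter on the run-B background: «`U_B = exp A_B` with
   `sup‖A_B‖ ≤ a`», `s₀ ≤ 2(2d+2)L·a`, `s₁ ≤ 4(2d+2)L·a`; with `a = σ_B·ξ_{k+1}` (a potential of size `σ_B` in FIELD units — [Balaban1985Variational]
   Thm 1 (9) p. 279 TYPE; a ONE-RUN binder, NOT in the tree, asserted nowhere) this is `s₀ ≤ 2(2d+2)σ_B·ξ_k`.
 * §2 `cornerValues_rescaleGauge` ∕ `isUnitarySite_rescaleGauge` ∕ `isPeriodicSite_rescaleGauge` ∕ **`isMinimiser_pair_gaugeAct`** — a gauge `u_B`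
   of run B (`N·L^{j+2}`-periodic) and its RESCALED copy `u_A := u_B ∘ (L•)` on run A's lattice (`N·L^{j+1}`-periodic) have the SAME corner
   values `ū = u_B ∘ (L^{j+2}•) = u_A ∘ (L^{j+1}•)` on the unit lattice; hence (by `NE7EtaMinimiserGaugeCovariance.isMinimiser_gaugeAct`) a
   minimiser pair `(U_A, U_B)` for the datum `V` at levels `j+1, j+2` is moved TOGETHER to a minimiser pair `(U_A^{u_A}, U_B^{u_B})` for the
   datum `ū·V` — so a carrier may put run B in a smooth gauge WITHOUT leaving the hypotheses of NE3's root (the root is quantified over all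
   data of `dom` and all minimiser pairs; it is then applied at `ū·V`, which must lie in `dom`: route 1's `dom` has to be gauge-invariant, as
   Bałaban's domains are).
 * §3 **`plain_closeness_of_covRoot₂_oneLetter`** (`d = 4`) — `plain_closeness_of_covRoot₂` with its two letters of `W` DISCHARGED from the one
   letter on `U_B` (`U_B = exp A_B`, `sup‖A_B‖ ≤ σ_B·θ^{6(k+1)}`, `10L·σ_B·θ^{6(k+1)} ≤ 1∕64`): bond distance `≤ 16l₁²γ·θ^{8k}` and plain gradient
   `≤ (4l₁√(2γΛ₂′) + 16l₁²γ·60σ_B + 128l₁⁴γ²)·θ^{13k}` (`σ₀ = 20σ_B`, `σ₁ = 40σ_B`, using `L·θ⁶ = 1`).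
CONSEQUENCE FOR THE BILL (G5): item (3) reads «ONE letter: the run-B minimiser, in some gauge `u_B`, is `exp A_B` with `sup‖A_B‖ ≤ σ_B·ξ_{k+1}`»
(+ item (4), the functionals' gauge invariance, to read the re-gauged pair); the pair is re-gauged consistently by §2.  HONEST.  Bookkeeping;
the root and the letter are HYPOTHESES; nothing of NE3∕NE7 discharged; no carrier instantiated; 0 def; 0 sorry; nothing printed is a
hypothesis of a theorem.
-/

set_option autoImplicit false

open scoped BigOperators Matrix Matrix.Norms.L2Operator
open Finset NormedSpace

namespace Summit.QuantumFields.BalabanUV.T4Continuum.NE7EtaSmoothGaugeTransport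

open Literature.MathematicalPhysics.QuantumFieldTheory.Balaban1983to89
open B7Prop1Explicit B7Prop2Explicit
open T4AveragingDeficitWall hiding Site Plane Plaq Bond
open T4AveragingDeficitWallBoundary (periodBox IsPeriodicCfg)
open AveragingDeficitPeriodicCounting (IsPeriodicDir)
open AveragingDeficitMultiLevelPrep (LevelSmall)
open MinimalActionSandwich (IsMinimiser)
open MinimalActionRate (Regular sfClass)
open NE3EnergyShapes (residualScale IsUnitarySite IsPeriodicSite)
open NE3EnergyWeightedShapes (energyNormW)
open AveragingDeficitDualResidual (dualC1 dualC2)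
open AveragingDeficitDerivWallProof (wallConst)
open NE7EtaPlainGradientLetters (plain_closeness_of_covRoot₂)
open NE7EtaMinimiserGaugeCovariance (isMinimiser_gaugeAct)

noncomputable section

variable {d : ℕ} {n : Type*} [Fintype n] [DecidableEq n]

/-! ## §1 The letters of `W = rescale L (bavg L U)` from ONE letter on `U` -/

/-- **ONE AVERAGING KEEPS A SMOOTH GAUGE** (the side estimate of [Balaban1985Averaging] p. 25, one call per coarse bond): if every bond variable of
`U` is `exp A_b` with `‖A_b‖ ≤ a` and `(2dL + 2L)·a ≤ 1∕64`, then `‖(rescale L (bavg L U))(z, κ) − 1‖ ≤ 2·(2dL + 2L)·a` for all `z, κ`.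
[cite: Balaban1985Averaging, p.25 (displays before (47))] -/
theorem norm_rescale_bavg_sub_one_le [Nonempty n] {L : ℕ} (hL : 1 ≤ L) {U : Site d → Fin d → (Matrix n n ℂ)ˣ}
    {A : Site d → Fin d → Matrix n n ℂ} {a : ℝ} (ha : 0 ≤ a)
    (hUA : ∀ x κ, ((U x κ : (Matrix n n ℂ)ˣ) : Matrix n n ℂ) = exp (A x κ) ∧ ‖A x κ‖ ≤ a)
    (hsmall : ((2 * (d * L) + L + L : ℕ) : ℝ) * a ≤ 1 / 64) (z : Site d) (κ : Fin d) :
    ‖((rescale L (bavg L U) z κ : (Matrix n n ℂ)ˣ) : Matrix n n ℂ) - 1‖ ≤ 2 * (((2 * (d * L) + L + L : ℕ) : ℝ) * a) := by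
  have hθ0 : 0 ≤ ((2 * (d * L) + L + L : ℕ) : ℝ) * a := mul_nonneg (by positivity) ha
  have h := side_estimate U A ((L : ℤ) • z) (2 * (d * L) + L + L) ha (fun x κ _ => hUA x κ) L hL ((L : ℤ) • z) κ
    (by simp [l1]) le_rfl hθ0 hsmall
  simpa only [rescale] using h.1

/-- **THE GRADIENT LETTER IS AT MOST TWICE THE SUP LETTER**: `‖W(x + e_μ, κ) − W(x, κ)‖ ≤ 2s₀` whenever `‖W_b − 1‖ ≤ s₀` on all bonds.
[folklore] -/
theorem letter_grad_of_sup {W : Site d → Fin d → (Matrix n n ℂ)ˣ} {s₀ : ℝ}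
    (hs₀ : ∀ x κ, ‖((W x κ : (Matrix n n ℂ)ˣ) : Matrix n n ℂ) - 1‖ ≤ s₀) (x : Site d) (μ κ : Fin d) :
    ‖((W (x + e μ) κ : (Matrix n n ℂ)ˣ) : Matrix n n ℂ) - ((W x κ : (Matrix n n ℂ)ˣ) : Matrix n n ℂ)‖ ≤ 2 * s₀ := by
  have hsplit : ((W (x + e μ) κ : (Matrix n n ℂ)ˣ) : Matrix n n ℂ) - ((W x κ : (Matrix n n ℂ)ˣ) : Matrix n n ℂ)
      = (((W (x + e μ) κ : (Matrix n n ℂ)ˣ) : Matrix n n ℂ) - 1) - (((W x κ : (Matrix n n ℂ)ˣ) : Matrix n n ℂ) - 1) := by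
    abel
  rw [hsplit]
  exact (norm_sub_le _ _).trans (by linarith [hs₀ (x + e μ) κ, hs₀ x κ])

/-! ## §2 The pair moved together: a gauge of run B and its rescaled copy on run A have the same corner values -/

/-- The corner values agree: `(u_B ∘ (L•)) (L^{j+1}·w) = u_B (L^{j+2}·w)`. [folklore] -/
theorem cornerValues_rescaleGauge (L j : ℕ) (uB : Site d → (Matrix n n ℂ)ˣ) :
    (fun w : Site d => (fun x : Site d => uB ((L : ℤ) • x)) (((L : ℤ) ^ (j + 1)) • w))
      = fun w : Site d => uB (((L : ℤ) ^ (j + 2)) • w) := by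
  funext w
  simp only [smul_smul]
  congr 1
  ring

/-- The rescaled copy of a unitary gauge is unitary. [folklore] -/
theorem isUnitarySite_rescaleGauge (L : ℕ) {uB : Site d → (Matrix n n ℂ)ˣ} (hu : IsUnitarySite uB) :
    IsUnitarySite fun x : Site d => uB ((L : ℤ) • x) :=
  fun x => hu ((L : ℤ) • x)

/-- The rescaled copy of an `N·L^{j+2}`-periodic gauge is `N·L^{j+1}`-periodic. [folklore] -/
theorem isPeriodicSite_rescaleGauge {L N j : ℕ} {uB : Site d → (Matrix n n ℂ)ˣ}
    (huP : IsPeriodicSite uB ((N * L ^ (j + 2) : ℕ) : ℤ)) :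
    IsPeriodicSite (fun x : Site d => uB ((L : ℤ) • x)) ((N * L ^ (j + 1) : ℕ) : ℤ) := by
  intro x i
  have e1 : (L : ℤ) • (x + ((N * L ^ (j + 1) : ℕ) : ℤ) • e i) = (L : ℤ) • x + ((N * L ^ (j + 2) : ℕ) : ℤ) • e i := by
    rw [smul_add, smul_smul]
    congr 2
    push_cast
    ring
  simp only [e1, huP ((L : ℤ) • x) i]

/-- **THE MINIMISER PAIR MOVED TOGETHER** ((F3) resolved on the root side): if `U_A` minimises run `j+1` and `U_B` run `j+2` for the SAME datum
`V` (small-field class, class smallness at both levels), and `u_B` is a unitary `N·L^{j+2}`-periodic gauge of run B with rescaled copy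
`u_A := u_B ∘ (L•)`, then `U_A^{u_A}` and `U_B^{u_B}` minimise runs `j+1` and `j+2` for the SAME moved datum `ū·V`, `ū w = u_B (L^{j+2}·w)`.
So NE3's root — quantified over all data of `dom` and all minimiser pairs — applies to the re-gauged pair at the datum `ū·V` (which must lie in
`dom`). [folklore] -/
theorem isMinimiser_pair_gaugeAct [Nonempty n] {L N : ℕ} (hL : 1 ≤ L) {ε : ℝ} (hε : 0 ≤ ε) (j : ℕ)
    (hsA : LevelSmall d L j (ε / ((L : ℝ) ^ (j + 1)) ^ 2)) (hsB : LevelSmall d L (j + 1) (ε / ((L : ℝ) ^ (j + 2)) ^ 2))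
    {V UA UB : Site d → Fin d → (Matrix n n ℂ)ˣ}
    (hA : IsMinimiser d (sfClass d L N ε) L N (j + 1) V UA) (hB : IsMinimiser d (sfClass d L N ε) L N (j + 2) V UB)
    {uB : Site d → (Matrix n n ℂ)ˣ} (hu : IsUnitarySite uB) (huP : IsPeriodicSite uB ((N * L ^ (j + 2) : ℕ) : ℤ)) :
    IsMinimiser d (sfClass d L N ε) L N (j + 1) (gaugeAct (fun w : Site d => uB (((L : ℤ) ^ (j + 2)) • w)) V)
        (gaugeAct (fun x : Site d => uB ((L : ℤ) • x)) UA) ∧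
      IsMinimiser d (sfClass d L N ε) L N (j + 2) (gaugeAct (fun w : Site d => uB (((L : ℤ) ^ (j + 2)) • w)) V)
        (gaugeAct uB UB) := by
  refine ⟨?_, isMinimiser_gaugeAct hL hε (j + 1) hsB hB hu huP⟩
  have h := isMinimiser_gaugeAct hL hε j hsA hA (isUnitarySite_rescaleGauge L hu) (isPeriodicSite_rescaleGauge huP)
  rw [cornerValues_rescaleGauge] at h
  exact h

/-! ## §3 The END with ONE letter on the run-B background (`d = 4`) -/

/-- **THE BACKGROUND COORDINATE IN THE PLAIN READING, FROM THE COVARIANT ROOT + ONE SMOOTH-GAUGE LETTER ON `U_B`** (`d = 4`).  As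
`NE7EtaPlainGradientLetters.plain_closeness_of_covRoot₂` (covariant root of amendment 4 verbatim, class data, budget `γ`, cube root `l₁`, fit,
`θ ≤ 1`, `8l₁²γθ^{8k} ≤ 1`), with its two letters of `W` REPLACED by: the given run-B minimiser is bondwise `exp A_B` with
`sup‖A_B‖ ≤ σ_B·θ^{6(k+1)}` (`σ_B ≥ 0`; a regular-gauge potential of size `σ_B` in field units — ONE-RUN binder, asserted nowhere) and the
smallness `10L·σ_B·θ^{6(k+1)} ≤ 1∕64`.  THEN `∃ u Z` with the representation and (i) bond distance `≤ 16l₁²γ·θ^{8k}`, (ii) plain gradient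
`≤ (4l₁√(2γΛ₂′) + 16l₁²γ·(60σ_B) + 128l₁⁴γ²)·θ^{13k}`. [folklore] -/
theorem plain_closeness_of_covRoot₂_oneLetter [Nonempty n] {𝒞 : ℕ → Set (Site 4 → Fin 4 → (Matrix n n ℂ)ˣ)} {L N : ℕ}
    (hL : 2 ≤ L) (hN : 1 ≤ N) {θ : ℝ} (hθ : 0 < θ) (hθ1 : θ ≤ 1) (hθ6 : θ ^ 6 = ((L : ℝ))⁻¹) {b g C Λ₁ Λ₂' : ℝ}
    (hb : 0 ≤ b) (hbs : 512 * (4 + 1) * (4 + 4) * (L : ℝ) ^ 2 * b ≤ 1) (hg : 0 ≤ g) (hC : 0 ≤ C) (hΛ₂' : 0 < Λ₂')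
    {dom : Set (Site 4 → Fin 4 → (Matrix n n ℂ)ˣ)}
    (h : ∀ k : ℕ, 1 ≤ k → ∀ V ∈ dom, ∀ UA UB : Site 4 → Fin 4 → (Matrix n n ℂ)ˣ,
      IsMinimiser 4 𝒞 L N k V UA → IsMinimiser 4 𝒞 L N (k + 1) V UB → Regular 4 L N b g (k + 1) UB →
        ∃ (u : Site 4 → (Matrix n n ℂ)ˣ) (Z : Site 4 → Fin 4 → Matrix n n ℂ),
          IsUnitarySite u ∧ IsPeriodicSite u ((N * L ^ k : ℕ) : ℤ) ∧
          IsSkewDir Z ∧ IsPeriodicDir Z ((N * L ^ k : ℕ) : ℤ) ∧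
          gaugeAct u UA = vary (rescale L (bavg L UB)) Z 1 ∧
          energyNormW L k (rescale L (bavg L UB)) Z (periodBox (N * L ^ k)) ≤ C * residualScale 4 L N b g k ∧
          (∀ (κ : Fin 4) (x : Site 4) (μ : Fin 4),
            ‖Ad (rescale L (bavg L UB) (x + e κ) μ) (Z (x + e μ) κ) - Z x κ‖ ≤ Λ₁ * (((L : ℝ)⁻¹) ^ k) ^ 2) ∧
          (∀ (κ μ : Fin 4) (y : Site 4),
            ‖Ad (rescale L (bavg L UB) (y + e κ) μ)
                (Ad (rescale L (bavg L UB) (y + e κ + e μ) μ) (Z (y + (2 : ℕ) • e μ) κ) - Z (y + e μ) κ)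
              - (Ad (rescale L (bavg L UB) (y + e κ) μ) (Z (y + e μ) κ) - Z y κ)‖ ≤ Λ₂' * (((L : ℝ)⁻¹) ^ k) ^ 3))
    {γ l₁ : ℝ} (hγ : 0 < γ)
    (hγ3 : C * (wallConst 4 L * (N : ℝ) ^ 2 * (Real.sqrt g * dualC2 4 L + 2 * b ^ 2 * dualC1 4 L)) ≤ γ ^ 3)
    (hl₁ : 0 < l₁) (hΛl₁ : Λ₁ ≤ l₁ ^ 3)
    {k : ℕ} (hk : 1 ≤ k) (hfit : γ * (θ ^ k) ^ 2 ≤ l₁ * N) (hp1 : 8 * l₁ ^ 2 * γ * θ ^ (8 * k) ≤ 1)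
    {V : Site 4 → Fin 4 → (Matrix n n ℂ)ˣ} (hV : V ∈ dom) {UA UB : Site 4 → Fin 4 → (Matrix n n ℂ)ˣ}
    (hA : IsMinimiser 4 𝒞 L N k V UA) (hB : IsMinimiser 4 𝒞 L N (k + 1) V UB) (hreg : Regular 4 L N b g (k + 1) UB)
    {σB : ℝ} (hσB : 0 ≤ σB) {AB : Site 4 → Fin 4 → Matrix n n ℂ}
    (hUB : ∀ x κ, ((UB x κ : (Matrix n n ℂ)ˣ) : Matrix n n ℂ) = exp (AB x κ) ∧ ‖AB x κ‖ ≤ σB * θ ^ (6 * (k + 1)))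
    (hsmooth : 10 * (L : ℝ) * (σB * θ ^ (6 * (k + 1))) ≤ 1 / 64) :
    ∃ (u : Site 4 → (Matrix n n ℂ)ˣ) (Z : Site 4 → Fin 4 → Matrix n n ℂ),
      IsUnitarySite u ∧ IsPeriodicSite u ((N * L ^ k : ℕ) : ℤ) ∧ IsSkewDir Z ∧ IsPeriodicDir Z ((N * L ^ k : ℕ) : ℤ) ∧
      gaugeAct u UA = vary (rescale L (bavg L UB)) Z 1 ∧
      (∀ (x : Site 4) (κ : Fin 4),
        ‖((gaugeAct u UA x κ : (Matrix n n ℂ)ˣ) : Matrix n n ℂ) - ((rescale L (bavg L UB) x κ : (Matrix n n ℂ)ˣ) : Matrix n n ℂ)‖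
          ≤ 16 * l₁ ^ 2 * γ * θ ^ (8 * k)) ∧
      (∀ (x : Site 4) (μ κ : Fin 4),
        ‖(((gaugeAct u UA (x + e μ) κ : (Matrix n n ℂ)ˣ) : Matrix n n ℂ)
              - ((rescale L (bavg L UB) (x + e μ) κ : (Matrix n n ℂ)ˣ) : Matrix n n ℂ))
            - (((gaugeAct u UA x κ : (Matrix n n ℂ)ˣ) : Matrix n n ℂ)
              - ((rescale L (bavg L UB) x κ : (Matrix n n ℂ)ˣ) : Matrix n n ℂ))‖
          ≤ (4 * l₁ * Real.sqrt (2 * γ * Λ₂') + 16 * l₁ ^ 2 * γ * (60 * σB) + 128 * l₁ ^ 4 * γ ^ 2) * θ ^ (13 * k)) := by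
  have hL1 : 1 ≤ L := by omega
  have hL0 : (0 : ℝ) < L := by exact_mod_cast (by omega : 0 < L)
  -- the averaged letter: `‖W_b − 1‖ ≤ 2·(10L)·a`, `a = σ_B θ^{6(k+1)}`, and `L·θ⁶ = 1` turns `θ^{6(k+1)}` into `θ^{6k}∕L`
  have hlen : ((2 * (4 * L) + L + L : ℕ) : ℝ) = 10 * (L : ℝ) := by push_cast; ring
  have ha0 : 0 ≤ σB * θ ^ (6 * (k + 1)) := mul_nonneg hσB (pow_nonneg hθ.le _)
  have hsmall' : ((2 * (4 * L) + L + L : ℕ) : ℝ) * (σB * θ ^ (6 * (k + 1))) ≤ 1 / 64 := by rw [hlen]; exact hsmooth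
  have hW0 : ∀ x κ, ‖((rescale L (bavg L UB) x κ : (Matrix n n ℂ)ˣ) : Matrix n n ℂ) - 1‖ ≤ (20 * σB) * θ ^ (6 * k) := by
    intro x κ
    have h1 := norm_rescale_bavg_sub_one_le (d := 4) hL1 ha0 hUB hsmall' x κ
    rw [hlen] at h1
    have e6 : (L : ℝ) * θ ^ (6 * (k + 1)) = θ ^ (6 * k) := by
      have : θ ^ (6 * (k + 1)) = θ ^ (6 * k) * θ ^ 6 := by
        rw [show 6 * (k + 1) = 6 * k + 6 by ring, pow_add]
      rw [this, hθ6]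
      field_simp
    calc _ ≤ 2 * (10 * (L : ℝ) * (σB * θ ^ (6 * (k + 1)))) := h1
      _ = 20 * σB * ((L : ℝ) * θ ^ (6 * (k + 1))) := by ring
      _ = 20 * σB * θ ^ (6 * k) := by rw [e6]
  have hW1 : ∀ x μ κ, ‖((rescale L (bavg L UB) (x + e μ) κ : (Matrix n n ℂ)ˣ) : Matrix n n ℂ)
      - ((rescale L (bavg L UB) x κ : (Matrix n n ℂ)ˣ) : Matrix n n ℂ)‖ ≤ (40 * σB) * θ ^ (6 * k) := by
    intro x μ κ
    have h2 := letter_grad_of_sup hW0 x μ κ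
    linarith
  have h20 : 0 ≤ 20 * σB := by positivity
  have h40 : 0 ≤ 40 * σB := by positivity
  have hend := plain_closeness_of_covRoot₂ hL hN hθ hθ1 hθ6 hb hbs hg hC hΛ₂' h hγ hγ3 hl₁ hΛl₁ hk hfit hp1 hV hA hB hreg
    h20 h40 hW0 hW1
  have e60 : 20 * σB + 40 * σB = 60 * σB := by ring
  rw [e60] at hend
  exact hend

end

end Summit.QuantumFields.BalabanUV.T4Continuum.NE7EtaSmoothGaugeTransport
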